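import Literature.MathematicalPhysics.QuantumFieldTheory.Balaban1983to89.B8LeafModelZd3Map
import Literature.MathematicalPhysics.QuantumFieldTheory.Balaban1983to89.B8Thm4ConcreteE
import Literature.MathematicalPhysics.QuantumFieldTheory.Balaban1983to89.B8LeafModelZdSockP5uE

/-!
# `Balaban1983to89.B8LeafKnitZd3E` — [Balaban1985RegularSpaces] THE N05 PROTOTYPE KNIT WITH THE REPAIRED PROPOSITION-5 UNIQUENESS SOCKET
# (`SockP5uE`), GENERIC OVER AN INDEX MAP `ι : J → ZdIdx d L`: Theorem 4 (p. 88) at one member / on `fam₃ ∘ ι`, the re-typed leaf `B8LeafRS`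
# and Theorem 2 as printed on `fam ∘ ι`, and the statements of record on the `Ω₀ = ℤᵈ` sub-family

statement-level skeleton of published theorems with citation tags; proofs where landed; nothing here is a claim about the
Yang–Mills mass gap

PDF held: `paper:balaban1985-cmp99-regular-spaces-gauge-fixing` (journal page = PDF page + 74); pp. 83, 87–88, 94–95.

WHY THIS FILE (cell `pub-ymgap`, seat `pub-ymgap-dag-n05-a` g7 = the OWNER of the Proposition-5 sockets of the N05 knit).  The E-CHAIN:
the knit of record `B8LeafKnitZd3B9All.b8LeafRS_zd3_univ_b9all` (sockets `SockHFP₀ SockHFP SockP5u SB9all`) re-run with the uniqueness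
socket `SockP5u` — LOCATED by the provider seat `pub-ymgap-dag-n04-b` g5 as not inhabitable by a proof of print's Proposition 5 —
replaced by the repaired `B8LeafModelZdSockP5uE.SockP5uE` (datum carried by `Ω₀` with (1.38) and the (1.62)-shape; competitors read at
every site and on every bond touching `Ω_j`), whose consumer is `B8Thm4ConcreteE.thm4Body_concrete_uniformE` (via `B8Thm4UniqueE`) and
whose provider is n04-b's `B8SockP5uEAssembly.sockP5uE_body_of_join′`.  At the INTERFACE ASK of `pub-ymgap-dag-n05-d` g0 (the
letters-fed knit lives on a law-restricted sub-family, LOCATED-1 2026-08-26) everything is stated over an arbitrary index map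
`ι : J → ZdIdx d L` with the sockets required on the image of `ι` only: Theorem 4 at ONE member with its four sockets inside
(`thm4Body_member_zd3E`, one threshold chosen before the member), on `fam₃ ∘ ι` (`thm4Printed_zd3_mapE`, `_of_HFP_mapE`, `_of_HFP₄_mapE`),
the re-typed leaf on `fam ∘ ι` from Theorem 4 as a hypothesis (`b8LeafRS_zd3_map_of_thm4`) and from the sockets
(`b8LeafRS_zd3_map_b9allE`), Theorem 2 as printed (`thm2_of135_zd3_map_b9allE`), and the statements OF RECORD at `ι := Subtype.val` on
`{i // i.Ω 0 = univ}` (`b8LeafRS_zd3_univ_b9allE`, `thm2_of135_zd3_univ_b9allE` — sockets on the sub-family, weaker than «at every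
`ZdIdx`»).  Everything is BY NAME over `B8LeafModelZd3Map` (Prop. 3 / Thm 2 generic glue), `B8LeafKnitZd3OfThm4`, `B8LeafSocketsB9`,
`B8LeafModelZdOfHFP` (adapters, antitonicity) and the landed Theorem-4 assembly (proof of `thm4Body_member_zd3E` = `thm4Printed_zd3`'s
verbatim on `thm4Body_concrete_uniformE`).

WHAT THIS FILE PROVES (kernel, 0 sorry, theorems only): `sockP5uE_anti`, `thm4Body_member_zd3E`, `thm4Printed_zd3_mapE`,
`thm4Printed_zd3_of_HFP_mapE`, `thm4Printed_zd3_of_HFP₄_mapE`, `b8LeafRS_zd3_map_of_thm4`, `b8LeafRS_zd3_map_b9allE`,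
`thm2_of135_zd3_map_b9allE`, `b8LeafRS_zd3_univ_b9allE`, `thm2_of135_zd3_univ_b9allE`.

HONEST SCOPE.  A knit BY NAME; the sockets `SockHFP₀` / `SockHFP` (Prop. 5 fixed point), `SockP5uE` (Prop. 5 uniqueness), `SB9all` ([4] Thm
3.3 in Prop. 3's frame, all levels) and the printed members `p5e p5u p6 p7 t8` remain HYPOTHESES; nothing of Propositions 3/5/6/7, Theorem 8,
[4] is proved here; the prototype's declared readings (`B8LeafModelZd3` docstring) apply.  Count-neutral; N05 NOT discharged; nothing
continuum / ℝ⁴ / OS / mass-gap / Clay.  Unit `pub-ymgap-dag-n05-a` (g7), 2026-08-26.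
-/

noncomputable section

open NormedSpace

namespace Literature.MathematicalPhysics.QuantumFieldTheory.Balaban1983to89.B8LeafKnitZd3E

open Complex (I)
open MatrixLog B7Prop1Explicit B7Prop2Explicit B7Prop1Local B7Eq92Concrete
open B7Prop2Explicit (C0 c2')
open B7Prop3Flat (c3)
open B8Ineq132 (covDerivFwd InAk BondTouches Under)
open B8Eq119TwistedAxial (Restr129 InAx)
open B8Eq184Proof (gaugeExp cfgExp)
open B8Lemma1NonAbelian (mulCfg blockPairNA lemma1Printed_blockPairNA)
open B8Eq140Level (SideTouches)
open B8Eq146AExpansion (iEta)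
open B7Prop4GeneralLevels (logCovIter linCovIter)
open B8Thm2LogB (blockTop)
open B8Ineq130 (tlo thi)
open B8Eq138LandauZd (IsLandau138W logCfg)
open B8Prop3GaugeFixedKLevel (mem_unitaryUnits_of_mgauge_eq)
open B8Thm4AtLandau138 (mgauge_mgauge_inv)
open B8Thm4ConcreteE (thm4Body_concrete_uniformE)
open B8Thm4Windows (thm4_windows thm4_windows_extra)
open B8LeafKnitRS (B8LeafRS)
open B8LeafModelZd (SockP5base SockP5 SockH59 ZdIdx)
open B8LeafModelZdSockP5uE (SockP5uE)
open B8LeafModelZdOfHFP (SockHFP₀ SockHFP windows4 sockP5base_of_sockHFP₀ sockP5_of_sockHFP sockH59_anti sockHFP₀_anti sockHFP_anti)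
open B8LeafModelZd3 (mlogCfg mlogCfg_spec zdGF3 SockB9P3)
open B8LeafModelZd3Map (prop3Printed_zd3_map thm2Printed_zd3_map_of_thm4 thm2_of135_zd3_map_of_thm2)
open B8LeafSocketsB9 (sockH59_of_allLevels sockB9P3_of_allLevels)

-- `Site` alone could resolve to the torus sites of `Setup.lean`; re-export the `ℤ^d` sites of `B7Prop1Explicit`.
export B7Prop1Explicit (Site)

variable {d : ℕ}

/-! ## §0 The repaired uniqueness socket is antitone in its threshold -/

section Anti

variable {𝔸 : Type*} [CStarAlgebra 𝔸]

/-- `SockP5uE` is antitone in the threshold `cP` (a provider below a smaller threshold serves a fortiori).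
[cite: Balaban1985RegularSpaces, Prop. 5 (1.109) p.94] -/
theorem sockP5uE_anti {L : ℕ} {B₀ cP cP' cu : ℝ} (h : cP' ≤ cP) {η : ℝ} {k : ℕ} {Ω : ℕ → Set (Site d)}
    {Λs : ℕ → ℕ → Set (Site d)} (S : SockP5uE (𝔸 := 𝔸) L B₀ cP cu η k Ω Λs) : SockP5uE (𝔸 := 𝔸) L B₀ cP' cu η k Ω Λs :=
  fun α₀ α₁ hα₀ hα₁ hs => S α₀ α₁ hα₀ hα₁ (hs.trans h)

end Anti

/-! ## §1 THEOREM 4 (p. 88) at ONE member (sockets inside, repaired uniqueness socket) and on an index-mapped sub-family -/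

section Thm4

variable {𝔸 : Type} [CStarAlgebra 𝔸] [Nontrivial 𝔸]

/-- **`B8.Thm4Body (5dLB₀)` AT ONE MEMBER of `zdGF3`, SOCKETS INSIDE, REPAIRED UNIQUENESS SOCKET** (Theorem 4, p. 88): the assembly of
`B8LeafModelZd3.thm4Printed_zd3` run on `B8Thm4ConcreteE.thm4Body_concrete_uniformE` — ONE threshold `c₁(d, L, B₀, B₀′, cu, cP)` chosen BEFORE
the member; the four sockets `SockP5base` / `SockP5` / `SockH59` / `SockP5uE` required AT THAT MEMBER only; (1.37) via the canonical masked
exponent `mlogCfg` and the (1.42) lemma as landed.  Proof = the landed one verbatim.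
[cite: Balaban1985RegularSpaces, Thm 4 p.88, (1.29) p.81, (1.37)–(1.38) p.82, (1.62) p.87, Prop. 5 (1.107)–(1.109) p.94, pp.94–95] -/
theorem thm4Body_member_zd3E (hd2 : 2 ≤ d) {L : ℕ} (hL : 2 ≤ L) (β : ℝ) (len : Site d → ℝ) {B₀ B₀' cu cP : ℝ} (hB₀ : 0 < B₀)
    (hB₀' : 0 < B₀') (hB : 2 ≤ 5 * (d : ℝ) * L * B₀) (hcu : 0 < cu) (hcP : 0 < cP) :
    ∃ c₁ : ℝ, 0 < c₁ ∧ ∀ i : ZdIdx d L,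
      SockP5base (𝔸 := 𝔸) L B₀ B₀' cP i.η i.k i.Ω i.Λs → SockP5 (𝔸 := 𝔸) L B₀ B₀' cP i.η i.k i.Ω i.Λs →
      SockH59 (𝔸 := 𝔸) L B₀ B₀' cP i.η i.k i.Ω i.Λs i.Λb → SockP5uE (𝔸 := 𝔸) L B₀ cP cu i.η i.k i.Ω i.Λs →
      B8.Thm4Body c₁ (5 * (d : ℝ) * L * B₀) (fun _ : Unit => (zdGF3 𝔸 L β len i).toGFData) := by
  have hL1 : 1 ≤ L := le_trans (by norm_num) hL
  have hd1 : 1 ≤ d := le_trans (by norm_num) hd2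
  have hL' : (1 : ℝ) ≤ L := by exact_mod_cast hL1
  obtain ⟨c₁, hc₁, H⟩ := thm4Body_concrete_uniformE (𝔸 := 𝔸) hd2 hL hB₀ hB₀' hB hcu hcP
  obtain ⟨cw, hcw, hw⟩ := thm4_windows hd1 hL1 hB₀ hB₀' hB
  obtain ⟨cw', hcw', hw'⟩ := thm4_windows_extra (d := d) hL1
  refine ⟨min c₁ (min cw cw'), lt_min hc₁ (lt_min hcw hcw'), ?_⟩
  intro i SP5base SP5 SH59 SP5u _ α₀ α₁ hα₀ hα₁ hs U₀ P hInA _ hInAAx h166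
  have hs₁ : α₀ + α₁ ≤ c₁ := hs.trans (min_le_left _ _)
  have hsw : α₀ + α₁ ≤ cw := hs.trans ((min_le_right _ _).trans (min_le_left _ _))
  have hsw' : α₀ + α₁ ≤ cw' := hs.trans ((min_le_right _ _).trans (min_le_right _ _))
  obtain ⟨hP1, h34, hAx⟩ := hInAAx
  obtain ⟨h135, h66⟩ := h166
  subst hP1
  obtain ⟨u, hu, huS, h129, hLan, hleaf, huniq⟩ := H i.η i.hη i.k i.Ω i.hΩ i.Λs i.Λb i.hbox i.hclass i.htower i.hpart
    SP5base SP5 SH59 SP5u α₀ α₁ hα₀ hα₁ hs₁ P.1.1 P.2.1 P.1.2 P.2.2 hInA h34 hAx h135 h66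
  -- windows for the (1.42) lemma
  obtain ⟨-, -, -, -, w5, w6, w7, -, w9, w10, -, -, -, -, -, -, -, -⟩ :=
    hw α₀ α₁ hα₀ hα₁ hsw (5 * (d : ℝ) * L * B₀ * (α₀ + α₁)) (8 * B₀' * (5 * (d : ℝ) * L * B₀) * (α₀ + α₁)) rfl rfl
  obtain ⟨w19, -⟩ := hw' α₀ α₁ hα₀ hα₁ hsw'
  have hcs0 : 0 ≤ 5 * (d : ℝ) * L * B₀ * (α₀ + α₁) := by positivity
  have hKS0 : 0 ≤ 2 * (L * (5 * (d : ℝ) * L * B₀ * (α₀ + α₁))) + 8 * (8 * B₀' * (5 * (d : ℝ) * L * B₀) * (α₀ + α₁)) := by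
    positivity
  have hcK : 5 * (d : ℝ) * L * B₀ * (α₀ + α₁) ≤
      2 * (L * (5 * (d : ℝ) * L * B₀ * (α₀ + α₁))) + 8 * (8 * B₀' * (5 * (d : ℝ) * L * B₀) * (α₀ + α₁)) := by
    have h₁ : (1 : ℝ) * (5 * (d : ℝ) * L * B₀ * (α₀ + α₁)) ≤ L * (5 * (d : ℝ) * L * B₀ * (α₀ + α₁)) :=
      mul_le_mul_of_nonneg_right hL' hcs0
    have h₂ : 0 ≤ 8 * (8 * B₀' * (5 * (d : ℝ) * L * B₀) * (α₀ + α₁)) := by positivity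
    linarith
  have hc16 : 16 * (5 * (d : ℝ) * L * B₀ * (α₀ + α₁)) ≤ 1 := by linarith
  -- the gauge-fixed field and its CANONICAL masked exponent
  have hW : mgauge P.1.1 u (mgauge P.1.1 u⁻¹ P.2.1) = P.2.1 := mgauge_mgauge_inv P.1.1 P.2.1 u
  have hWu : ∀ x κ, mgauge P.1.1 u⁻¹ P.2.1 x κ ∈ unitaryUnits 𝔸 := mem_unitaryUnits_of_mgauge_eq P.1.2 P.2.2 hu hW
  have hWA : ∀ j, j ≤ i.k → ∀ y τ, SideTouches (i.Ω j) y τ →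
      mgauge P.1.1 u⁻¹ P.2.1 y τ = cfgExp i.η (logCfg i.η (mgauge P.1.1 u⁻¹ P.2.1)) y τ ∧
        ‖logCfg i.η (mgauge P.1.1 u⁻¹ P.2.1) y τ‖ ≤ (5 * (d : ℝ) * L * B₀ * (α₀ + α₁)) * ((L : ℝ) ^ j * i.η)⁻¹ :=
    fun j hj y τ h => ⟨(hleaf j hj (y, τ) h).1, (hleaf j hj (y, τ) h).2.2⟩
  obtain ⟨hA'sa, hA'eq, hA'zero⟩ := mlogCfg_spec i.hη hL1 i.k P.1.1 hWu hcs0 hc16 i.Ω hWA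
  set A' := mlogCfg i.k i.η i.Ω (mgauge P.1.1 u⁻¹ P.2.1) with hA'_def
  have hA'bd : ∀ j, j ≤ i.k → ∀ y τ, SideTouches (i.Ω j) y τ →
      mgauge P.1.1 u⁻¹ P.2.1 y τ = cfgExp i.η A' y τ ∧
        ‖A' y τ‖ ≤ (2 * (L * (5 * (d : ℝ) * L * B₀ * (α₀ + α₁))) + 8 * (8 * B₀' * (5 * (d : ℝ) * L * B₀) * (α₀ + α₁))) *
          ((L : ℝ) ^ j * i.η)⁻¹ := by
    intro j hj y τ h
    obtain ⟨hAA, hWexp⟩ := hA'eq j hj y τ h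
    refine ⟨hWexp, ?_⟩
    rw [hAA]
    have hη0 : 0 ≤ i.η := i.hη.le
    exact ((hWA j hj y τ h).2).trans (mul_le_mul_of_nonneg_right hcK (by positivity))
  have h137 := B8Eq142KLevelLocal.H42_of_inAx hd2 i.hη hL i.k P.1.2 hα₀ hα₁ hKS0 w5 w6 w7 w9 w10 w19 i.Ω i.hΩ i.Λs i.Λb i.hbox
    i.hclass hInA h34 hAx h135 (fun m W => IsLandau138W L m i.η (i.Ω 0) (i.Λs m) P.1.1 W) i.k i.hk le_rfl u
    (mgauge P.1.1 u⁻¹ P.2.1) A' hu hW h129 (hLan i.hk) hA'sa hA'bd hA'zero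
  refine ⟨⟨u, hu, huS⟩, h129, ⟨h137, hLan i.hk, ?_⟩, ?_⟩
  · intro j hj b hb
    exact hleaf j hj b hb
  · intro u' hR' _ hLan' h162'
    apply Subtype.ext
    refine huniq u'.1 u'.2.1 u'.2.2 hR' hLan' ⟨logCfg i.η (mgauge P.1.1 u'.1⁻¹ P.2.1), fun j hj x κ h => ?_⟩ i.hk
    exact ⟨(h162' j hj (x, κ) h).1, (h162' j hj (x, κ) h).2.2⟩

/-- **`B8.Thm4Printed (5dLB₀)` ON AN INDEX-MAPPED SUB-FAMILY `fam₃ ∘ ι`** of `zdGF3` (`ι : J → ZdIdx d L`), from the four sockets on the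
image of `ι` only (repaired uniqueness socket). [cite: Balaban1985RegularSpaces, Thm 4 p.88, Prop. 5 p.94, (1.59) p.86] -/
theorem thm4Printed_zd3_mapE (hd2 : 2 ≤ d) {L : ℕ} (hL : 2 ≤ L) {β : ℝ} {len : Site d → ℝ} {B₀ B₀' cu cP : ℝ} (hB₀ : 0 < B₀)
    (hB₀' : 0 < B₀') (hB : 2 ≤ 5 * (d : ℝ) * L * B₀) (hcu : 0 < cu) (hcP : 0 < cP)
    {J : Type} (ι : J → ZdIdx d L)
    (SP5base : ∀ j : J, SockP5base (𝔸 := 𝔸) L B₀ B₀' cP (ι j).η (ι j).k (ι j).Ω (ι j).Λs)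
    (SP5 : ∀ j : J, SockP5 (𝔸 := 𝔸) L B₀ B₀' cP (ι j).η (ι j).k (ι j).Ω (ι j).Λs)
    (SH59 : ∀ j : J, SockH59 (𝔸 := 𝔸) L B₀ B₀' cP (ι j).η (ι j).k (ι j).Ω (ι j).Λs (ι j).Λb)
    (SP5u : ∀ j : J, SockP5uE (𝔸 := 𝔸) L B₀ cP cu (ι j).η (ι j).k (ι j).Ω (ι j).Λs) :
    B8.Thm4Printed (5 * (d : ℝ) * L * B₀) (fun j : J => (zdGF3 𝔸 L β len (ι j)).toGFData) := by
  obtain ⟨c₁, hc₁, H⟩ := thm4Body_member_zd3E (𝔸 := 𝔸) hd2 hL β len hB₀ hB₀' hB hcu hcP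
  exact ⟨c₁, hc₁, fun j => H (ι j) (SP5base j) (SP5 j) (SH59 j) (SP5u j) ()⟩

/-- **… with the two Proposition-5 EXISTENCE sockets in PLAIN FIXED-POINT CURRENCY** (`SockHFP₀` / `SockHFP`), by the landed adapters
`sockP5base_of_sockHFP₀` / `sockP5_of_sockHFP` below the common threshold `min cP c₁` (`c₁` of `windows4`), the other two by antitonicity.
[cite: Balaban1985RegularSpaces, Thm 4 p.88, Prop. 5 (1.106)–(1.109) p.94, pp.94–95] -/
theorem thm4Printed_zd3_of_HFP_mapE (hd2 : 2 ≤ d) {L : ℕ} (hL : 2 ≤ L) {β : ℝ} {len : Site d → ℝ} {B₀ B₀' cu cP : ℝ} (hB₀ : 0 < B₀)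
    (hB₀' : 0 < B₀') (hB : 2 ≤ 5 * (d : ℝ) * L * B₀) (hcu : 0 < cu) (hcP : 0 < cP)
    {J : Type} (ι : J → ZdIdx d L)
    (SHFP₀ : ∀ j : J, SockHFP₀ (𝔸 := 𝔸) L B₀ B₀' cP (ι j).η (ι j).k (ι j).Ω (ι j).Λs)
    (SHFP : ∀ j : J, SockHFP (𝔸 := 𝔸) L B₀ B₀' cP (ι j).η (ι j).k (ι j).Ω (ι j).Λs)
    (SH59 : ∀ j : J, SockH59 (𝔸 := 𝔸) L B₀ B₀' cP (ι j).η (ι j).k (ι j).Ω (ι j).Λs (ι j).Λb)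
    (SP5u : ∀ j : J, SockP5uE (𝔸 := 𝔸) L B₀ cP cu (ι j).η (ι j).k (ι j).Ω (ι j).Λs) :
    B8.Thm4Printed (5 * (d : ℝ) * L * B₀) (fun j : J => (zdGF3 𝔸 L β len (ι j)).toGFData) := by
  have hL1 : 1 ≤ L := le_trans (by norm_num) hL
  have hd1 : 1 ≤ d := le_trans (by norm_num) hd2
  obtain ⟨c₁, hc₁, hwin⟩ := windows4 hd1 hL1 hB₀ hB₀' hB
  have hm₁ : min cP c₁ ≤ cP := min_le_left _ _
  have hwin' : ∀ α₀ α₁ : ℝ, 0 < α₀ → 0 < α₁ → α₀ + α₁ ≤ min cP c₁ →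
      8 * B₀' * (5 * (d : ℝ) * L * B₀) * (α₀ + α₁) ≤ 1 / 84 ∧ L * (5 * (d : ℝ) * L * B₀ * (α₀ + α₁)) ≤ 1 / 12 ∧
        α₁ ≤ 1 / 4 ∧ 2 * α₁ ≤ 5 * (d : ℝ) * L * B₀ * (α₀ + α₁) :=
    fun α₀ α₁ hα₀ hα₁ hs => hwin α₀ α₁ hα₀ hα₁ (hs.trans (min_le_right _ _))
  exact thm4Printed_zd3_mapE hd2 hL hB₀ hB₀' hB hcu (lt_min hcP hc₁) ι
    (fun j => sockP5base_of_sockHFP₀ hd2 (ι j).hη hL1 hB₀.le hm₁ hwin' (SHFP₀ j))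
    (fun j => sockP5_of_sockHFP hd2 (ι j).hη hL1 hB₀.le hm₁ hwin' (SHFP j))
    (fun j => sockH59_anti hm₁ (SH59 j)) (fun j => sockP5uE_anti hm₁ (SP5u j))

/-- **… and with four INDEPENDENT provider thresholds** (the form the providers deliver in).
[cite: Balaban1985RegularSpaces, Thm 4 p.88 («there exists a constant c₁»), Prop. 5 p.94, (1.59) p.86] -/
theorem thm4Printed_zd3_of_HFP₄_mapE (hd2 : 2 ≤ d) {L : ℕ} (hL : 2 ≤ L) {β : ℝ} {len : Site d → ℝ} {B₀ B₀' cu cF₀ cF c59 cu' : ℝ}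
    (hB₀ : 0 < B₀) (hB₀' : 0 < B₀') (hB : 2 ≤ 5 * (d : ℝ) * L * B₀) (hcu : 0 < cu) (hcF₀ : 0 < cF₀) (hcF : 0 < cF)
    (hc59 : 0 < c59) (hcu' : 0 < cu')
    {J : Type} (ι : J → ZdIdx d L)
    (SHFP₀ : ∀ j : J, SockHFP₀ (𝔸 := 𝔸) L B₀ B₀' cF₀ (ι j).η (ι j).k (ι j).Ω (ι j).Λs)
    (SHFP : ∀ j : J, SockHFP (𝔸 := 𝔸) L B₀ B₀' cF (ι j).η (ι j).k (ι j).Ω (ι j).Λs)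
    (SH59 : ∀ j : J, SockH59 (𝔸 := 𝔸) L B₀ B₀' c59 (ι j).η (ι j).k (ι j).Ω (ι j).Λs (ι j).Λb)
    (SP5u : ∀ j : J, SockP5uE (𝔸 := 𝔸) L B₀ cu' cu (ι j).η (ι j).k (ι j).Ω (ι j).Λs) :
    B8.Thm4Printed (5 * (d : ℝ) * L * B₀) (fun j : J => (zdGF3 𝔸 L β len (ι j)).toGFData) := by
  set cP : ℝ := min (min cF₀ cF) (min c59 cu') with hcPdef
  have hcP : 0 < cP := lt_min (lt_min hcF₀ hcF) (lt_min hc59 hcu')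
  have h₁ : cP ≤ cF₀ := (min_le_left _ _).trans (min_le_left _ _)
  have h₂ : cP ≤ cF := (min_le_left _ _).trans (min_le_right _ _)
  have h₃ : cP ≤ c59 := (min_le_right _ _).trans (min_le_left _ _)
  have h₄ : cP ≤ cu' := (min_le_right _ _).trans (min_le_right _ _)
  exact thm4Printed_zd3_of_HFP_mapE hd2 hL hB₀ hB₀' hB hcu hcP ι (fun j => sockHFP₀_anti h₁ (SHFP₀ j))
    (fun j => sockHFP_anti h₂ (SHFP j)) (fun j => sockH59_anti h₃ (SH59 j)) (fun j => sockP5uE_anti h₄ (SP5u j))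

end Thm4

/-! ## §2 The re-typed leaf `B8LeafRS` on an index-mapped sub-family with `Ω₀ = ℤᵈ` -/

section Knit

variable {𝔸 : Type} [CStarAlgebra 𝔸] [Nontrivial 𝔸]
variable {I₃ I₄ : Type} {lan : I₃ → B8.LandauData} {cub : I₄ → B8.CubeData}

/-- **THE RE-TYPED B8 LEAF ON AN INDEX-MAPPED SUB-FAMILY FROM THEOREM 4 AS A HYPOTHESIS** (socket-free glue, generic over
`ι : J → ZdIdx d L` with `(ι j).Ω 0 = univ`): `t4 := H4`, `p3 := prop3Printed_zd3_map SB9`, `t2 := thm2Printed_zd3_map_of_thm4 H4 p3`,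
`l1 := lemma1Printed_blockPairNA`, the five remaining printed members as hypotheses.
[cite: Balaban1985RegularSpaces, Lemma 1 p.79, Thm 2 p.83, Prop. 3 p.87, Thm 4 p.88; Prop. 5 p.94, Prop. 6 p.99, Prop. 7 p.100, Thm 8 p.101 (named hypotheses)] -/
theorem b8LeafRS_zd3_map_of_thm4 (hd2 : 2 ≤ d) {L : ℕ} (hL : 2 ≤ L) (Lb : ℕ) (β : ℝ) (len : Site d → ℝ) (inp : B8.B9Inputs)
    {B₀β C₂ cB9 B₁ B₂ c₁ : ℝ} (hB : 2 ≤ 5 * (d : ℝ) * L * inp.B₀) (hB₀β : 0 < B₀β)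
    (hC₂ : 2097152 * ((d : ℝ) + 1) ^ 2 ≤ C₂) (hcB9 : 0 < cB9)
    {J : Type} (ι : J → ZdIdx d L) (hΩ : ∀ j, (ι j).Ω 0 = Set.univ)
    (H4 : B8.Thm4Printed (5 * (d : ℝ) * L * inp.B₀) (fun j : J => (zdGF3 𝔸 L β len (ι j)).toGFData))
    (SB9 : ∀ j : J, SockB9P3 (𝔸 := 𝔸) L inp.B₀ B₀β cB9 β len (ι j).η (ι j).k (ι j).Ω (ι j).Λs (ι j).Λb)
    {toAxial : ∀ j : J, (zdGF3 𝔸 L β len (ι j)).Cfg → (zdGF3 𝔸 L β len (ι j)).Pert → (zdGF3 𝔸 L β len (ι j)).Pert}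
    (p5e : B8.Prop5Exists inp.B₀' B₁ lan) (p5u : B8.Prop5Unique lan) (p6 : B8.Prop6Printed d (L : ℝ) B₁ c₁ cub)
    (p7 : B8SectGH.Prop7PrintedR (fun j : J => zdGF3 𝔸 L β len (ι j)) toAxial)
    (t8 : B8Thm8Surviving.Thm8SurvivingAt 1 B₁ B₂ (fun j : J => zdGF3 𝔸 L β len (ι j))) :
    B8LeafRS d (L : ℝ) C₂ (5 * (d : ℝ) * L * inp.B₀) inp.B₀' B₁ B₂ c₁ inp B₀β (blockPairNA d Lb 𝔸)
      (fun j : J => zdGF3 𝔸 L β len (ι j)) lan cub toAxial where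
  l1 := lemma1Printed_blockPairNA d Lb 𝔸
  t2 := thm2Printed_zd3_map_of_thm4 hd2 hL inp.B₀_pos inp.B₀'_pos hB₀β hB ι hΩ H4
    (prop3Printed_zd3_map hd2 hL ⟨inp.B₀, inp.B₀', inp.B₀_pos, inp.B₀'_pos⟩ hB₀β.le le_rfl hcB9 β len ι SB9)
  p3 := prop3Printed_zd3_map hd2 hL inp hB₀β.le hC₂ hcB9 β len ι SB9
  t4 := H4
  p5e := p5e
  p5u := p5u
  p6 := p6
  p7 := p7
  t8 := t8

/-- **THE RE-TYPED B8 LEAF ON AN INDEX-MAPPED SUB-FAMILY, REPAIRED UNIQUENESS SOCKET, b9 AS ONE ALL-LEVELS SOCKET** — the E-twin of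
`B8LeafKnitZd3B9All.b8LeafRS_zd3_univ_b9all`, generic over `ι : J → ZdIdx d L` with `(ι j).Ω 0 = univ`: sockets `SockHFP₀` / `SockHFP`
(Prop. 5 fixed point, plain currency), **`SockP5uE`** (Prop. 5 uniqueness, repaired), `SB9all` (b9, all levels — serving `SockH59` below
`min cB9 (cB9/K₀)` and `SockB9P3` at `cB9` by `B8LeafSocketsB9`) on the image of `ι`, and the printed members `p5e p5u p6 p7 t8`.
[cite: Balaban1985RegularSpaces, Lemma 1 p.79, Thm 2 p.83, Prop. 3 p.87, Thm 4 p.88, (1.59) p.86; Prop. 5 p.94, Prop. 6 p.99, Prop. 7 p.100, Thm 8 p.101 (named hypotheses)] -/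
theorem b8LeafRS_zd3_map_b9allE (hd2 : 2 ≤ d) {L : ℕ} (hL : 2 ≤ L) (Lb : ℕ) (β : ℝ) (len : Site d → ℝ) (inp : B8.B9Inputs)
    {B₀β C₂ cu cF₀ cF cu' cB9 B₁ B₂ c₁ : ℝ} (hB : 2 ≤ 5 * (d : ℝ) * L * inp.B₀) (hB₀β : 0 < B₀β)
    (hC₂ : 2097152 * ((d : ℝ) + 1) ^ 2 ≤ C₂) (hcu : 0 < cu) (hcF₀ : 0 < cF₀) (hcF : 0 < cF) (hcu' : 0 < cu') (hcB9 : 0 < cB9)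
    {J : Type} (ι : J → ZdIdx d L) (hΩ : ∀ j, (ι j).Ω 0 = Set.univ)
    (SHFP₀ : ∀ j : J, SockHFP₀ (𝔸 := 𝔸) L inp.B₀ inp.B₀' cF₀ (ι j).η (ι j).k (ι j).Ω (ι j).Λs)
    (SHFP : ∀ j : J, SockHFP (𝔸 := 𝔸) L inp.B₀ inp.B₀' cF (ι j).η (ι j).k (ι j).Ω (ι j).Λs)
    (SP5u : ∀ j : J, SockP5uE (𝔸 := 𝔸) L inp.B₀ cu' cu (ι j).η (ι j).k (ι j).Ω (ι j).Λs)
    (SB9all : ∀ j : J, ∀ m, m ≤ (ι j).k → SockB9P3 (𝔸 := 𝔸) L inp.B₀ B₀β cB9 β len (ι j).η m (ι j).Ω (ι j).Λs (ι j).Λb)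
    {toAxial : ∀ j : J, (zdGF3 𝔸 L β len (ι j)).Cfg → (zdGF3 𝔸 L β len (ι j)).Pert → (zdGF3 𝔸 L β len (ι j)).Pert}
    (p5e : B8.Prop5Exists inp.B₀' B₁ lan) (p5u : B8.Prop5Unique lan) (p6 : B8.Prop6Printed d (L : ℝ) B₁ c₁ cub)
    (p7 : B8SectGH.Prop7PrintedR (fun j : J => zdGF3 𝔸 L β len (ι j)) toAxial)
    (t8 : B8Thm8Surviving.Thm8SurvivingAt 1 B₁ B₂ (fun j : J => zdGF3 𝔸 L β len (ι j))) :
    B8LeafRS d (L : ℝ) C₂ (5 * (d : ℝ) * L * inp.B₀) inp.B₀' B₁ B₂ c₁ inp B₀β (blockPairNA d Lb 𝔸)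
      (fun j : J => zdGF3 𝔸 L β len (ι j)) lan cub toAxial := by
  have hd1 : 1 ≤ d := le_trans (by norm_num) hd2
  have hL1 : 1 ≤ L := le_trans (by norm_num) hL
  have hd' : (1 : ℝ) ≤ d := by exact_mod_cast hd1
  have hL' : (1 : ℝ) ≤ L := by exact_mod_cast hL1
  have hB₀ := inp.B₀_pos
  have hB₀' := inp.B₀'_pos
  -- Theorem 4's b9 socket below `min cB9 (cB9 / K₀)`
  have hK₀ : 0 < 2 * (L * (5 * (d : ℝ) * L * inp.B₀)) + 8 * (8 * inp.B₀' * (5 * (d : ℝ) * L * inp.B₀)) := by positivity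
  have hc59 : 0 < min cB9 (cB9 / (2 * (L * (5 * (d : ℝ) * L * inp.B₀)) + 8 * (8 * inp.B₀' * (5 * (d : ℝ) * L * inp.B₀)))) :=
    lt_min hcB9 (div_pos hcB9 hK₀)
  exact b8LeafRS_zd3_map_of_thm4 hd2 hL Lb β len inp hB hB₀β hC₂ hcB9 ι hΩ
    (thm4Printed_zd3_of_HFP₄_mapE hd2 hL hB₀ hB₀' hB hcu hcF₀ hcF hc59 hcu' ι SHFP₀ SHFP
      (fun j => sockH59_of_allLevels hd1 hL1 hB₀ hB₀'.le hcB9 (SB9all j)) SP5u)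
    (fun j => sockB9P3_of_allLevels (SB9all j)) p5e p5u p6 p7 t8

/-- **THEOREM 2 AS PRINTED ((1.35) on Λ_j) ON AN INDEX-MAPPED SUB-FAMILY, REPAIRED UNIQUENESS SOCKET, b9 AS ONE ALL-LEVELS SOCKET** — the
E-twin of `B8LeafKnitZd3B9All.thm2_of135_zd3_univ_b9all` (chair R453 (C)), generic over `ι` with `(ι j).Ω 0 = univ`:
`thm2_of135_zd3_map_of_thm2 ∘ thm2Printed_zd3_map_of_thm4 ∘ (thm4Printed_zd3_of_HFP₄_mapE, prop3Printed_zd3_map)`.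
[cite: Balaban1985RegularSpaces, Thm 2 p.83, (1.35) p.82, Thm 4 p.88, Prop. 3 p.87, (1.65) p.87, (1.59) p.86, Prop. 5 p.94] -/
theorem thm2_of135_zd3_map_b9allE (hd2 : 2 ≤ d) {L : ℕ} (hL : 2 ≤ L) {β : ℝ} {len : Site d → ℝ}
    {B₀ B₀' B₀β cu cF₀ cF cu' cB9 : ℝ} (hB₀ : 0 < B₀) (hB₀' : 0 < B₀') (hB₀β : 0 < B₀β) (hB : 2 ≤ 5 * (d : ℝ) * L * B₀)
    (hcu : 0 < cu) (hcF₀ : 0 < cF₀) (hcF : 0 < cF) (hcu' : 0 < cu') (hcB9 : 0 < cB9)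
    {J : Type} (ι : J → ZdIdx d L) (hΩ : ∀ j, (ι j).Ω 0 = Set.univ)
    (SHFP₀ : ∀ j : J, SockHFP₀ (𝔸 := 𝔸) L B₀ B₀' cF₀ (ι j).η (ι j).k (ι j).Ω (ι j).Λs)
    (SHFP : ∀ j : J, SockHFP (𝔸 := 𝔸) L B₀ B₀' cF (ι j).η (ι j).k (ι j).Ω (ι j).Λs)
    (SP5u : ∀ j : J, SockP5uE (𝔸 := 𝔸) L B₀ cu' cu (ι j).η (ι j).k (ι j).Ω (ι j).Λs)
    (SB9all : ∀ j : J, ∀ m, m ≤ (ι j).k → SockB9P3 (𝔸 := 𝔸) L B₀ B₀β cB9 β len (ι j).η m (ι j).Ω (ι j).Λs (ι j).Λb) :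
    ∃ B₁ B₂ c₁ : ℝ, 0 < B₁ ∧ 0 < B₂ ∧ 0 < c₁ ∧
      ∀ i : J,
        (∀ ℓ, ℓ ≤ (ι i).k → ∀ w : Site d, (∀ x, InBox (tlo L w ℓ) (thi L w ℓ) x → x ∈ (ι i).Ω ℓ) →
          ∃ j, ℓ ≤ j ∧ j ≤ (ι i).k ∧ ∃ y ∈ (ι i).Λs (ι i).k j, Under L (j - ℓ) y w) →
        ∀ α₀ α₁ : ℝ, 0 < α₀ → 0 < α₁ → α₀ + α₁ ≤ c₁ →
          ∀ (U₀ : (zdGF3 𝔸 L β len (ι i)).Cfg) (P : (zdGF3 𝔸 L β len (ι i)).Pert),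
            (zdGF3 𝔸 L β len (ι i)).InA α₀ U₀ → (zdGF3 𝔸 L β len (ι i)).Reg335 α₀ U₀ → (zdGF3 𝔸 L β len (ι i)).InAAx α₀ U₀ P →
            (∀ j, j ≤ (ι i).k → ∀ (z : Site d) (μ : Fin d), BondTouches ((ι i).Λs (ι i).k j) z μ →
              (∀ x, InBox (loK L j z) (bondHiK L j z μ) x → x ∈ (ι i).Ω j) →
              ‖(avgIter L (mulCfg P.2.1 U₀.1) j z μ : 𝔸) - (avgIter L U₀.1 j z μ : 𝔸)‖ ≤ α₁) →
            ∃ u : (zdGF3 𝔸 L β len (ι i)).GT, (zdGF3 𝔸 L β len (ι i)).Restricted U₀ u ∧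
              ((zdGF3 𝔸 L β len (ι i)).C136 B₁ B₂ (α₀ + (11 * (d : ℝ) ^ 2 * α₀ + α₁)) U₀ ((zdGF3 𝔸 L β len (ι i)).act P u) ∧
                (zdGF3 𝔸 L β len (ι i)).C137 α₁ U₀ ((zdGF3 𝔸 L β len (ι i)).act P u) ∧
                (zdGF3 𝔸 L β len (ι i)).Landau U₀ ((zdGF3 𝔸 L β len (ι i)).act P u) ∧
                (zdGF3 𝔸 L β len (ι i)).C139 B₁ (α₀ + (11 * (d : ℝ) ^ 2 * α₀ + α₁)) U₀ ((zdGF3 𝔸 L β len (ι i)).act P u)) ∧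
              ∀ u' : (zdGF3 𝔸 L β len (ι i)).GT, (zdGF3 𝔸 L β len (ι i)).Restricted U₀ u' →
                (zdGF3 𝔸 L β len (ι i)).C136 B₁ B₂ (α₀ + (11 * (d : ℝ) ^ 2 * α₀ + α₁)) U₀ ((zdGF3 𝔸 L β len (ι i)).act P u') →
                (zdGF3 𝔸 L β len (ι i)).C137 α₁ U₀ ((zdGF3 𝔸 L β len (ι i)).act P u') →
                (zdGF3 𝔸 L β len (ι i)).Landau U₀ ((zdGF3 𝔸 L β len (ι i)).act P u') →
                (zdGF3 𝔸 L β len (ι i)).C139 B₁ (α₀ + (11 * (d : ℝ) ^ 2 * α₀ + α₁)) U₀ ((zdGF3 𝔸 L β len (ι i)).act P u') →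
                  u' = u := by
  have hd1 : 1 ≤ d := le_trans (by norm_num) hd2
  have hL1 : 1 ≤ L := le_trans (by norm_num) hL
  have hd' : (1 : ℝ) ≤ d := by exact_mod_cast hd1
  have hL' : (1 : ℝ) ≤ L := by exact_mod_cast hL1
  have hK₀ : 0 < 2 * (L * (5 * (d : ℝ) * L * B₀)) + 8 * (8 * B₀' * (5 * (d : ℝ) * L * B₀)) := by positivity
  have hc59 : 0 < min cB9 (cB9 / (2 * (L * (5 * (d : ℝ) * L * B₀)) + 8 * (8 * B₀' * (5 * (d : ℝ) * L * B₀)))) :=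
    lt_min hcB9 (div_pos hcB9 hK₀)
  exact thm2_of135_zd3_map_of_thm2 hd2 hL ι
    (thm2Printed_zd3_map_of_thm4 hd2 hL hB₀ hB₀' hB₀β hB ι hΩ
      (thm4Printed_zd3_of_HFP₄_mapE hd2 hL hB₀ hB₀' hB hcu hcF₀ hcF hc59 hcu' ι SHFP₀ SHFP
        (fun j => sockH59_of_allLevels hd1 hL1 hB₀ hB₀'.le hcB9 (SB9all j)) SP5u)
      (prop3Printed_zd3_map hd2 hL ⟨B₀, B₀', hB₀, hB₀'⟩ hB₀β.le le_rfl hcB9 β len ι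
        (fun j => sockB9P3_of_allLevels (SB9all j))))

end Knit

/-! ## §3 The statements OF RECORD: the `Ω₀ = ℤᵈ` sub-family (`ι := Subtype.val`), sockets on the sub-family only -/

section OfRecord

variable {𝔸 : Type} [CStarAlgebra 𝔸] [Nontrivial 𝔸]
variable {I₃ I₄ : Type} {lan : I₃ → B8.LandauData} {cub : I₄ → B8.CubeData}

/-- **THE RE-TYPED B8 LEAF AT THE PROTOTYPE (`Ω₀ = ℤᵈ` sub-family), REPAIRED UNIQUENESS SOCKET** — the E-twin of
`B8LeafKnitZd3B9All.b8LeafRS_zd3_univ_b9all`: sockets `SockHFP₀ SockHFP SockP5uE SB9all` ON THE SUB-FAMILY (weaker than «at every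
`ZdIdx`»), printed members `p5e p5u p6 p7 t8`.  (= `b8LeafRS_zd3_map_b9allE` at `ι := Subtype.val`.)
[cite: Balaban1985RegularSpaces, Lemma 1 p.79, Thm 2 p.83, Prop. 3 p.87, Thm 4 p.88, (1.59) p.86; Prop. 5 p.94, Prop. 6 p.99, Prop. 7 p.100, Thm 8 p.101 (named hypotheses)] -/
theorem b8LeafRS_zd3_univ_b9allE (hd2 : 2 ≤ d) {L : ℕ} (hL : 2 ≤ L) (Lb : ℕ) (β : ℝ) (len : Site d → ℝ) (inp : B8.B9Inputs)
    {B₀β C₂ cu cF₀ cF cu' cB9 B₁ B₂ c₁ : ℝ} (hB : 2 ≤ 5 * (d : ℝ) * L * inp.B₀) (hB₀β : 0 < B₀β)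
    (hC₂ : 2097152 * ((d : ℝ) + 1) ^ 2 ≤ C₂) (hcu : 0 < cu) (hcF₀ : 0 < cF₀) (hcF : 0 < cF) (hcu' : 0 < cu') (hcB9 : 0 < cB9)
    (SHFP₀ : ∀ i : {i : ZdIdx d L // i.Ω 0 = Set.univ}, SockHFP₀ (𝔸 := 𝔸) L inp.B₀ inp.B₀' cF₀ i.1.η i.1.k i.1.Ω i.1.Λs)
    (SHFP : ∀ i : {i : ZdIdx d L // i.Ω 0 = Set.univ}, SockHFP (𝔸 := 𝔸) L inp.B₀ inp.B₀' cF i.1.η i.1.k i.1.Ω i.1.Λs)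
    (SP5u : ∀ i : {i : ZdIdx d L // i.Ω 0 = Set.univ}, SockP5uE (𝔸 := 𝔸) L inp.B₀ cu' cu i.1.η i.1.k i.1.Ω i.1.Λs)
    (SB9all : ∀ i : {i : ZdIdx d L // i.Ω 0 = Set.univ}, ∀ m, m ≤ i.1.k →
      SockB9P3 (𝔸 := 𝔸) L inp.B₀ B₀β cB9 β len i.1.η m i.1.Ω i.1.Λs i.1.Λb)
    {toAxial : ∀ i : {i : ZdIdx d L // i.Ω 0 = Set.univ}, (zdGF3 𝔸 L β len i.1).Cfg → (zdGF3 𝔸 L β len i.1).Pert →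
      (zdGF3 𝔸 L β len i.1).Pert}
    (p5e : B8.Prop5Exists inp.B₀' B₁ lan) (p5u : B8.Prop5Unique lan) (p6 : B8.Prop6Printed d (L : ℝ) B₁ c₁ cub)
    (p7 : B8SectGH.Prop7PrintedR (fun i : {i : ZdIdx d L // i.Ω 0 = Set.univ} => zdGF3 𝔸 L β len i.1) toAxial)
    (t8 : B8Thm8Surviving.Thm8SurvivingAt 1 B₁ B₂ (fun i : {i : ZdIdx d L // i.Ω 0 = Set.univ} => zdGF3 𝔸 L β len i.1)) :
    B8LeafRS d (L : ℝ) C₂ (5 * (d : ℝ) * L * inp.B₀) inp.B₀' B₁ B₂ c₁ inp B₀β (blockPairNA d Lb 𝔸)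
      (fun i : {i : ZdIdx d L // i.Ω 0 = Set.univ} => zdGF3 𝔸 L β len i.1) lan cub toAxial :=
  b8LeafRS_zd3_map_b9allE hd2 hL Lb β len inp hB hB₀β hC₂ hcu hcF₀ hcF hcu' hcB9
    (Subtype.val : {i : ZdIdx d L // i.Ω 0 = Set.univ} → ZdIdx d L) (fun i => i.2) SHFP₀ SHFP SP5u SB9all p5e p5u p6 p7 t8

/-- **THEOREM 2 AS PRINTED ((1.35) on Λ_j) ON THE `Ω₀ = ℤᵈ` SUB-FAMILY, REPAIRED UNIQUENESS SOCKET** — the E-twin of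
`B8LeafKnitZd3B9All.thm2_of135_zd3_univ_b9all` (chair R453 (C)), sockets on the sub-family only.
[cite: Balaban1985RegularSpaces, Thm 2 p.83, (1.35) p.82, (1.65) p.87, (1.59) p.86, Prop. 5 p.94] -/
theorem thm2_of135_zd3_univ_b9allE (hd2 : 2 ≤ d) {L : ℕ} (hL : 2 ≤ L) {β : ℝ} {len : Site d → ℝ}
    {B₀ B₀' B₀β cu cF₀ cF cu' cB9 : ℝ} (hB₀ : 0 < B₀) (hB₀' : 0 < B₀') (hB₀β : 0 < B₀β) (hB : 2 ≤ 5 * (d : ℝ) * L * B₀)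
    (hcu : 0 < cu) (hcF₀ : 0 < cF₀) (hcF : 0 < cF) (hcu' : 0 < cu') (hcB9 : 0 < cB9)
    (SHFP₀ : ∀ i : {i : ZdIdx d L // i.Ω 0 = Set.univ}, SockHFP₀ (𝔸 := 𝔸) L B₀ B₀' cF₀ i.1.η i.1.k i.1.Ω i.1.Λs)
    (SHFP : ∀ i : {i : ZdIdx d L // i.Ω 0 = Set.univ}, SockHFP (𝔸 := 𝔸) L B₀ B₀' cF i.1.η i.1.k i.1.Ω i.1.Λs)
    (SP5u : ∀ i : {i : ZdIdx d L // i.Ω 0 = Set.univ}, SockP5uE (𝔸 := 𝔸) L B₀ cu' cu i.1.η i.1.k i.1.Ω i.1.Λs)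
    (SB9all : ∀ i : {i : ZdIdx d L // i.Ω 0 = Set.univ}, ∀ m, m ≤ i.1.k →
      SockB9P3 (𝔸 := 𝔸) L B₀ B₀β cB9 β len i.1.η m i.1.Ω i.1.Λs i.1.Λb) :
    ∃ B₁ B₂ c₁ : ℝ, 0 < B₁ ∧ 0 < B₂ ∧ 0 < c₁ ∧
      ∀ i : {i : ZdIdx d L // i.Ω 0 = Set.univ},
        (∀ ℓ, ℓ ≤ i.1.k → ∀ w : Site d, (∀ x, InBox (tlo L w ℓ) (thi L w ℓ) x → x ∈ i.1.Ω ℓ) →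
          ∃ j, ℓ ≤ j ∧ j ≤ i.1.k ∧ ∃ y ∈ i.1.Λs i.1.k j, Under L (j - ℓ) y w) →
        ∀ α₀ α₁ : ℝ, 0 < α₀ → 0 < α₁ → α₀ + α₁ ≤ c₁ →
          ∀ (U₀ : (zdGF3 𝔸 L β len i.1).Cfg) (P : (zdGF3 𝔸 L β len i.1).Pert),
            (zdGF3 𝔸 L β len i.1).InA α₀ U₀ → (zdGF3 𝔸 L β len i.1).Reg335 α₀ U₀ → (zdGF3 𝔸 L β len i.1).InAAx α₀ U₀ P →
            (∀ j, j ≤ i.1.k → ∀ (z : Site d) (μ : Fin d), BondTouches (i.1.Λs i.1.k j) z μ →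
              (∀ x, InBox (loK L j z) (bondHiK L j z μ) x → x ∈ i.1.Ω j) →
              ‖(avgIter L (mulCfg P.2.1 U₀.1) j z μ : 𝔸) - (avgIter L U₀.1 j z μ : 𝔸)‖ ≤ α₁) →
            ∃ u : (zdGF3 𝔸 L β len i.1).GT, (zdGF3 𝔸 L β len i.1).Restricted U₀ u ∧
              ((zdGF3 𝔸 L β len i.1).C136 B₁ B₂ (α₀ + (11 * (d : ℝ) ^ 2 * α₀ + α₁)) U₀ ((zdGF3 𝔸 L β len i.1).act P u) ∧
                (zdGF3 𝔸 L β len i.1).C137 α₁ U₀ ((zdGF3 𝔸 L β len i.1).act P u) ∧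
                (zdGF3 𝔸 L β len i.1).Landau U₀ ((zdGF3 𝔸 L β len i.1).act P u) ∧
                (zdGF3 𝔸 L β len i.1).C139 B₁ (α₀ + (11 * (d : ℝ) ^ 2 * α₀ + α₁)) U₀ ((zdGF3 𝔸 L β len i.1).act P u)) ∧
              ∀ u' : (zdGF3 𝔸 L β len i.1).GT, (zdGF3 𝔸 L β len i.1).Restricted U₀ u' →
                (zdGF3 𝔸 L β len i.1).C136 B₁ B₂ (α₀ + (11 * (d : ℝ) ^ 2 * α₀ + α₁)) U₀ ((zdGF3 𝔸 L β len i.1).act P u') →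
                (zdGF3 𝔸 L β len i.1).C137 α₁ U₀ ((zdGF3 𝔸 L β len i.1).act P u') →
                (zdGF3 𝔸 L β len i.1).Landau U₀ ((zdGF3 𝔸 L β len i.1).act P u') →
                (zdGF3 𝔸 L β len i.1).C139 B₁ (α₀ + (11 * (d : ℝ) ^ 2 * α₀ + α₁)) U₀ ((zdGF3 𝔸 L β len i.1).act P u') →
                  u' = u :=
  thm2_of135_zd3_map_b9allE hd2 hL hB₀ hB₀' hB₀β hB hcu hcF₀ hcF hcu' hcB9
    (Subtype.val : {i : ZdIdx d L // i.Ω 0 = Set.univ} → ZdIdx d L) (fun i => i.2) SHFP₀ SHFP SP5u SB9all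

end OfRecord

#print axioms sockP5uE_anti
#print axioms thm4Body_member_zd3E
#print axioms thm4Printed_zd3_mapE
#print axioms thm4Printed_zd3_of_HFP₄_mapE
#print axioms b8LeafRS_zd3_map_of_thm4
#print axioms b8LeafRS_zd3_map_b9allE
#print axioms thm2_of135_zd3_map_b9allE
#print axioms b8LeafRS_zd3_univ_b9allE
#print axioms thm2_of135_zd3_univ_b9allE

end Literature.MathematicalPhysics.QuantumFieldTheory.Balaban1983to89.B8LeafKnitZd3E

end
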